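import Summits.Ventures.CertifiedArithmetic.LowPrec.SRPythagorasTrunc
import HarnessLib

/-!
# Stochastic rounding in low-precision formats XCIV — StochasticA across MANY binades: nested one-signed
# windows, the bit threshold `N ≥ J`, drift-antitonicity and the Pythagorean MSE law for every `n`

HONEST FRAMING: certified error envelopes and provably optimal rounding/accumulation schemes for
low-precision formats under stated cost models; every table by two implementations; no hardware or
vendor claims.

XCIII (`SRPythagorasTrunc`) proved `E(ŝₙ − sₙ)² ≤ n·G²/4 + (n·ε·G)²` for IEEE P3109 StochasticA
(`ε = 2^{-N}`: away-probability `⌊2^N θ⌋/2^N`; `SR_{p,r}` of [ElararEtAl2025]) across ONE binade boundary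
and recorded that across two boundaries one random bit is not drift-antitone
(`Formats.e3m2_threeBinade_A1_not`).  The many-binade case is settled here, over any ordered field:
* `LimitedBits.NestedWindow F lo hi g J`: `lo, hi ∈ F`, the window points of `F` lie on `lo + gℤ`, every
  nondegenerate cell met in `[lo, hi]` has width `2^j·g` with `j ≤ J`, and widths do not decrease from
  left to right — the shape of every one-signed window of every binary format (spacings double at each
  binade boundary; two-block windows of XCIII are the case `J = 1`; the structural proof for `valueSet φ`
  of every `Format` is file XCV `SRPythagorasNestedFormats`);
* THE LEVER (`NestedWindow.truncErr_le`): with `N ≥ J` random bits the mean truncation error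
  `c − E[SR_A(c)] = (c − ⌊c̄⌋_F) mod ρ(c)`, `ρ(c) = width(c)/2^N`, is NONDECREASING along grid-congruent
  window points `c ≤ c'`, `c' − c ∈ gℤ`: every sub-quantum divides `g` (this is exactly where `N ≥ J`
  enters: `resid_add_mul_pow`) and a residue can only grow when read modulo a MULTIPLE
  (`resid_le_resid_mul : y mod ρ ≤ y mod mρ`); inside one cell the mean map is a translation.  Hence the
  step mean is monotone and `1`-Lipschitz (`stepQA_lever`), the `n`-step mean contracts
  (`accExpQA_contract`, induction over the tree), StochasticA trees are DRIFT-ANTITONE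
  (`driftAntitone_stochasticA`) and XCII's `accExpQ_sq_le_of_driftAntitone` yields the law with
  `G = 2^J·g`, `ε = 2^{-N}`, for EVERY `n` (`stochasticA_acc_sq_le`).
Scope (honest): one-signed windows (`0 ≤ lo`; negative windows by the sign symmetry of value sets), no
saturation; `N ≥ J` is what the antitone route needs and is attained at `J = 2` (XCV:
`Formats.e3m2_threeBinade_A2_law` vs. XCIII's one-bit witness) — whether the LAW survives fewer bits
across `≥ 3` binades is not decided here (sr-seat certificate gen17/nested: no violation found, evidence
only).  Prior art: [ElararEtAl2025, Thm. 3–4] (first-order relative model of `SR_{p,r}`); [XiaEtAl2022];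
[ConnollyHighamMary2021, Lemma 4.4]; IEEE P3109.  No Mathlib precedent.
-/


namespace Summit.Ventures.CertifiedArithmetic.LowPrec.SR

open Literature.ComputerArithmetic.ConnollyHighamMary2021
open Finset

variable {K : Type*} [Field K] [LinearOrder K] [IsStrictOrderedRing K] [FloorRing K]

namespace LimitedBits

/-! ### Residues: range, multiples, nesting -/

/-- `0 ≤ y mod ρ < ρ`. -/
theorem resid_nonneg_lt {y ρ : K} (hρ : 0 < ρ) : 0 ≤ resid y ρ ∧ resid y ρ < ρ := by
  unfold resid
  have h1 := Int.floor_le (y / ρ)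
  have h2 := Int.lt_floor_add_one (y / ρ)
  rw [le_div_iff₀ hρ] at h1
  rw [div_lt_iff₀ hρ] at h2
  constructor <;> linarith

/-- Sub-quanta that divide the grid: if `j ≤ N`, residues mod `2^j·ρ₀` ignore multiples of `2^N·ρ₀`. -/
theorem resid_add_mul_pow {y ρ₀ : K} (hρ₀ : 0 < ρ₀) {j N : ℕ} (hjN : j ≤ N) (M : ℤ) :
    resid (y + M * (2 ^ N * ρ₀)) (2 ^ j * ρ₀) = resid y (2 ^ j * ρ₀) := by
  have e : (M : K) * (2 ^ N * ρ₀) = ((M * 2 ^ (N - j) : ℤ) : K) * (2 ^ j * ρ₀) := by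
    push_cast
    rw [show (2 : K) ^ N = 2 ^ (N - j) * 2 ^ j by rw [← pow_add, Nat.sub_add_cancel hjN]]
    ring
  rw [e, resid_add_mul (by positivity)]

/-- NESTING: reading an offset modulo a multiple of `ρ` can only increase the residue,
`y mod ρ ≤ y mod (m·ρ)` (`m ≥ 1`). -/
theorem resid_le_resid_mul {y ρ : K} (hρ : 0 < ρ) {m : ℕ} (hm : 0 < m) :
    resid y ρ ≤ resid y (m * ρ) := by
  unfold resid
  have hmρ : (0 : K) < m * ρ := by positivity
  have h1 := Int.floor_le (y / (m * ρ))
  rw [le_div_iff₀ hmρ] at h1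
  have k1 : (m : ℤ) * ⌊y / (m * ρ)⌋ ≤ ⌊y / ρ⌋ := by
    rw [Int.le_floor]; push_cast
    rw [le_div_iff₀ hρ]
    linarith
  have k1' : (m : K) * (⌊y / (m * ρ)⌋ : K) ≤ (⌊y / ρ⌋ : K) := by exact_mod_cast k1
  nlinarith [mul_le_mul_of_nonneg_left k1' hρ.le]

/-! ### The truncation step on a nonnegative cell -/

/-- On a nonnegative cell the StochasticA mean lies in `[⌊c̄⌋_F, c̄]`. -/
theorem dn_le_stepQA_le (F : Finset K) (N : ℕ) {c : K} (hc : InHull F c) (hd : 0 ≤ dn F c) :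
    dn F c ≤ stepQ F (probAwayA N) c (fun y => y) ∧ stepQ F (probAwayA N) c (fun y => y) ≤ c := by
  constructor
  · obtain ⟨hp0, -⟩ := pUpQ_mem F (probAwayA_mem N) c
    have hg := dn_le_up F c
    unfold stepQ
    nlinarith
  · have h := (stepQ_towards_zero F (fun η _ _ => probAwayA_le N η) c).1 hd
    rwa [clamp_eq_self hc] at h

/-! ### Nested windows -/

/-- `NestedWindow F lo hi g J`: `lo, hi ∈ F`, every window point of `F` lies on `lo + g·ℤ`, every
nondegenerate cell met in `[lo, hi]` has width `2^j·g` with `j ≤ J`, and widths do not decrease from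
left to right (one-signed windows of binary formats: spacings double at each binade boundary). -/
structure NestedWindow (F : Finset K) (lo hi g : K) (J : ℕ) : Prop where
  lo_mem : lo ∈ F
  hi_mem : hi ∈ F
  pos : 0 < g
  grid : ∀ a ∈ F, lo ≤ a → a ≤ hi → a - lo = ⌊(a - lo) / g⌋ * g
  width : ∀ c, lo ≤ c → c ≤ hi → up F c ≠ dn F c → ∃ j, j ≤ J ∧ up F c - dn F c = 2 ^ j * g
  mono : ∀ c c', lo ≤ c → c ≤ c' → c' ≤ hi → up F c' ≠ dn F c' →
    up F c - dn F c ≤ up F c' - dn F c'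

namespace NestedWindow

variable {F : Finset K} {lo hi g : K} {J : ℕ}

omit [IsStrictOrderedRing K] in
/-- Window points lie in the hull of `F`. -/
theorem inHull (hW : NestedWindow F lo hi g J) {c : K} (h1 : lo ≤ c) (h2 : c ≤ hi) : InHull F c :=
  ⟨⟨lo, hW.lo_mem, h1⟩, ⟨hi, hW.hi_mem, h2⟩⟩

omit [IsStrictOrderedRing K] in
/-- The candidates of a window point: values inside the window bracketing the point. -/
theorem cand (hW : NestedWindow F lo hi g J) {c : K} (h1 : lo ≤ c) (h2 : c ≤ hi) :
    dn F c ∈ F ∧ up F c ∈ F ∧ lo ≤ dn F c ∧ up F c ≤ hi ∧ dn F c ≤ c ∧ c ≤ up F c := by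
  have hcl := clamp_eq_self (hW.inHull h1 h2)
  unfold dn up; rw [hcl]
  exact ⟨roundDown_mem ⟨lo, hW.lo_mem, h1⟩, roundUp_mem ⟨hi, hW.hi_mem, h2⟩,
    le_roundDown_of_mem hW.lo_mem h1, roundUp_le_of_mem hW.hi_mem h2, roundDown_le F c,
    le_roundUp F c⟩

omit [IsStrictOrderedRing K] in
/-- Cells of a finite value set: if `c ≤ c'` and the lower candidate of `c'` is below the upper
candidate of `c`, the two points share their cell. -/
theorem cell_eq (hW : NestedWindow F lo hi g J) {c c' : K} (h1 : lo ≤ c) (hcc : c ≤ c')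
    (h2 : c' ≤ hi) (hlt : dn F c' < up F c) : dn F c' = dn F c ∧ up F c' = up F c := by
  obtain ⟨hdF, huF, -, -, hdc, -⟩ := hW.cand h1 (hcc.trans h2)
  obtain ⟨hdF', huF', -, -, -, hcu'⟩ := hW.cand (h1.trans hcc) h2
  exact ⟨le_antisymm (le_dn_of_lt_up hdF' hlt) (le_dn_of_mem hdF (hdc.trans hcc)),
    le_antisymm (up_le_of_dn_lt huF hlt) (up_le_of_mem huF' (hcc.trans hcu'))⟩

/-- Every candidate gap met inside a nested window is `≤ 2^J·g`. -/
theorem gapLE (hW : NestedWindow F lo hi g J) :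
    ∀ (x : ℕ → K) (n : ℕ) (s : K), InWindow F lo hi x n s → GapLE F (2 ^ J * g) x n s := by
  intro x n
  induction n generalizing x with
  | zero => intro s _; trivial
  | succ n ih =>
    rintro s ⟨⟨h1, h2⟩, hwu, hwd⟩
    refine ⟨?_, ih _ _ hwu, ih _ _ hwd⟩
    have hg := hW.pos
    have hcl : clamp F (clamp F (s + x 0)) = clamp F (s + x 0) := clamp_eq_self (hW.inHull h1 h2)
    have hwid := hW.width (clamp F (s + x 0)) h1 h2
    unfold up dn at hwid; rw [hcl] at hwid
    by_cases hne : roundUp F (clamp F (s + x 0)) = roundDown F (clamp F (s + x 0))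
    · rw [hne, sub_self]; positivity
    · obtain ⟨j, hj, hwj⟩ := hwid hne
      rw [hwj]
      exact mul_le_mul_of_nonneg_right (pow_le_pow_right₀ (by norm_num) hj) hg.le

/-- A window grid point `c` whose cell is nondegenerate of width `2^j·g`, `j ≤ N`: if `c − ⌊c̄⌋ ∈ gℤ`
then StochasticA does not move it in the mean (`E[SR_A(c)] = c`). -/
theorem stepQA_eq_self (hW : NestedWindow F lo hi g J) (hlo : 0 ≤ lo) {N : ℕ} {c : K} (h1 : lo ≤ c)
    (h2 : c ≤ hi) {j : ℕ} (hjN : j ≤ N) (hwj : up F c - dn F c = 2 ^ j * g) {M : ℤ}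
    (hM : c - dn F c = M * g) : stepQ F (probAwayA N) c (fun y => y) = c := by
  obtain ⟨-, -, hlod, -, -, -⟩ := hW.cand h1 h2
  have hg := hW.pos
  set ρ₀ : K := g / 2 ^ N with hρ₀
  have hρ₀p : 0 < ρ₀ := by positivity
  have hgρ : g = 2 ^ N * ρ₀ := by rw [hρ₀]; field_simp
  rw [stepQA_cell F N (hW.inHull h1 h2) (hlo.trans hlod) (by positivity : (0 : K) < 2 ^ j * ρ₀)
    (Or.inr (by linear_combination hwj + (2 : K) ^ j * hgρ)), hM, hgρ]
  have h := resid_add_mul_pow (y := 0) hρ₀p hjN M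
  rw [zero_add] at h
  rw [h]; simp [resid]

/-- **Monotone mean truncation error (the lever).**  For window points `c ≤ c'` with `c' − c ∈ gℤ`
and `N ≥ J` random bits: `c − E[SR_A(c)] ≤ c' − E[SR_A(c')]`. -/
theorem truncErr_le (hW : NestedWindow F lo hi g J) (hlo : 0 ≤ lo) {N : ℕ} (hJN : J ≤ N) {c c' : K}
    (h1 : lo ≤ c) (hcc : c ≤ c') (h2 : c' ≤ hi) {k : ℤ} (hk : c' - c = k * g) :
    c - stepQ F (probAwayA N) c (fun y => y) ≤ c' - stepQ F (probAwayA N) c' (fun y => y) := by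
  have hc := hW.inHull h1 (hcc.trans h2)
  have hc' := hW.inHull (h1.trans hcc) h2
  obtain ⟨hdF, -, hlod, -, hdc, hcu⟩ := hW.cand h1 (hcc.trans h2)
  obtain ⟨hdF', -, hlod', -, hdc', hcu'⟩ := hW.cand (h1.trans hcc) h2
  have hd0 : 0 ≤ dn F c := hlo.trans hlod
  have hd0' : 0 ≤ dn F c' := hlo.trans hlod'
  have hg := hW.pos
  have hm := hW.grid _ hdF hlod (hdc.trans (hcc.trans h2))
  have hm' := hW.grid _ hdF' hlod' (hdc'.trans h2)
  set m : ℤ := ⌊(dn F c - lo) / g⌋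
  set m' : ℤ := ⌊(dn F c' - lo) / g⌋
  set ρ₀ : K := g / 2 ^ N with hρ₀
  have hρ₀p : 0 < ρ₀ := by positivity
  have hgρ : g = 2 ^ N * ρ₀ := by rw [hρ₀]; field_simp
  -- the two offsets differ by a grid multiple
  have e : c' - dn F c' = (c - dn F c) + ((k + m - m' : ℤ) : K) * (2 ^ N * ρ₀) := by
    rw [← hgρ]; push_cast; linear_combination hk + hm - hm'
  by_cases hne' : up F c' = dn F c'
  · -- `c'` is a value: its error is `0`, and so is the error of `c` (its offset is a grid multiple)
    have hc'd : c' = dn F c' := le_antisymm (hne' ▸ hcu') hdc'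
    have ht' : stepQ F (probAwayA N) c' (fun y => y) = c' := by
      have := dn_le_stepQA_le F N hc' hd0'
      rw [← hc'd] at this; exact le_antisymm this.2 this.1
    by_cases hne : up F c = dn F c
    · have hcd : c = dn F c := le_antisymm (hne ▸ hcu) hdc
      have := dn_le_stepQA_le F N hc hd0
      rw [← hcd] at this; rw [ht', le_antisymm this.2 this.1]; simp
    · obtain ⟨j, hj, hwj⟩ := hW.width c h1 (hcc.trans h2) hne
      have hM : c - dn F c = ((m' - m - k : ℤ) : K) * g := by
        push_cast; linear_combination hm' - hm - hk + hc'd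
      rw [ht', hW.stepQA_eq_self hlo h1 (hcc.trans h2) (hj.trans hJN) hwj hM]; linarith
  · obtain ⟨j', hj', hwj'⟩ := hW.width c' (h1.trans hcc) h2 hne'
    have hw' : up F c' = dn F c' ∨ up F c' = dn F c' + 2 ^ N * (2 ^ j' * ρ₀) :=
      Or.inr (by linear_combination hwj' + (2 : K) ^ j' * hgρ)
    rw [stepQA_cell F N hc' hd0' (by positivity) hw', e, resid_add_mul_pow hρ₀p (hj'.trans hJN)]
    by_cases hne : up F c = dn F c
    · have hcd : c = dn F c := le_antisymm (hne ▸ hcu) hdc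
      have := dn_le_stepQA_le F N hc hd0
      rw [← hcd] at this ⊢; rw [le_antisymm this.2 this.1, sub_self]
      have := (resid_nonneg_lt (y := (0 : K)) (by positivity : (0 : K) < 2 ^ j' * ρ₀)).1
      linarith
    · obtain ⟨j, hj, hwj⟩ := hW.width c h1 (hcc.trans h2) hne
      have hw : up F c = dn F c ∨ up F c = dn F c + 2 ^ N * (2 ^ j * ρ₀) :=
        Or.inr (by linear_combination hwj + (2 : K) ^ j * hgρ)
      rw [stepQA_cell F N hc hd0 (by positivity) hw]
      have hjj : j ≤ j' := by
        have hle := hW.mono c c' h1 hcc h2 hne'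
        rw [hwj, hwj'] at hle
        have := le_of_mul_le_mul_right hle hg
        exact (pow_le_pow_iff_right₀ (by norm_num : (1 : K) < 2)).mp this
      have em : (2 : K) ^ j' * ρ₀ = ((2 ^ (j' - j) : ℕ) : K) * (2 ^ j * ρ₀) := by
        push_cast; rw [← mul_assoc, ← pow_add, Nat.sub_add_cancel hjj]
      have := resid_le_resid_mul (y := c - dn F c) (by positivity : (0 : K) < 2 ^ j * ρ₀)
        (m := 2 ^ (j' - j)) (by positivity)
      rw [← em] at this
      linarith

/-- **Monotone and `1`-Lipschitz step mean.**  With `N ≥ J` random bits the one-step mean `τ` of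
StochasticA satisfies `0 ≤ τ(c') − τ(c) ≤ c' − c` for window points `c ≤ c'`, `c' − c ∈ gℤ` (inside one
cell `τ` is a translation; across cells `τ(c) ≤ c̄ ≤ ⌈c̄⌉ ≤ ⌊c̄'⌋ ≤ τ(c')` and `truncErr_le`). -/
theorem stepQA_lever (hW : NestedWindow F lo hi g J) (hlo : 0 ≤ lo) {N : ℕ} (hJN : J ≤ N) {c c' : K}
    (h1 : lo ≤ c) (hcc : c ≤ c') (h2 : c' ≤ hi) {k : ℤ} (hk : c' - c = k * g) :
    stepQ F (probAwayA N) c (fun y => y) ≤ stepQ F (probAwayA N) c' (fun y => y) ∧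
      stepQ F (probAwayA N) c' (fun y => y) - stepQ F (probAwayA N) c (fun y => y) ≤ c' - c := by
  have hc := hW.inHull h1 (hcc.trans h2)
  have hc' := hW.inHull (h1.trans hcc) h2
  obtain ⟨-, -, hlod, -, hdc, hcu⟩ := hW.cand h1 (hcc.trans h2)
  obtain ⟨-, -, hlod', -, hdc', hcu'⟩ := hW.cand (h1.trans hcc) h2
  have hτ := dn_le_stepQA_le F N hc (hlo.trans hlod)
  have hτ' := dn_le_stepQA_le F N hc' (hlo.trans hlod')
  by_cases hsep : up F c ≤ dn F c'
  · exact ⟨by linarith [hτ.2, hτ'.1], by linarith [hW.truncErr_le hlo hJN h1 hcc h2 hk]⟩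
  · -- same cell: the mean map is a translation by `c' − c`
    obtain ⟨hdd, huu⟩ := hW.cell_eq h1 hcc h2 (not_le.mp hsep)
    have hg := hW.pos
    by_cases hne : up F c = dn F c
    · -- degenerate cell: `c = c'`
      have hc'c : c' ≤ c := by
        have h := hcu'
        rw [huu, hne] at h
        exact h.trans hdc
      obtain rfl : c' = c := le_antisymm hc'c hcc
      exact ⟨le_rfl, by simp⟩
    · obtain ⟨j, hj, hwj⟩ := hW.width c h1 (hcc.trans h2) hne
      set ρ₀ : K := g / 2 ^ N with hρ₀
      have hρ₀p : 0 < ρ₀ := by positivity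
      have hgρ : g = 2 ^ N * ρ₀ := by rw [hρ₀]; field_simp
      have hw : up F c = dn F c ∨ up F c = dn F c + 2 ^ N * (2 ^ j * ρ₀) :=
        Or.inr (by linear_combination hwj + (2 : K) ^ j * hgρ)
      have hw' : up F c' = dn F c' ∨ up F c' = dn F c' + 2 ^ N * (2 ^ j * ρ₀) := by
        rw [hdd, huu]; exact hw
      have e : c' - dn F c = (c - dn F c) + (k : K) * (2 ^ N * ρ₀) := by
        rw [← hgρ]; linear_combination hk
      rw [stepQA_cell F N hc (hlo.trans hlod) (by positivity) hw,
        stepQA_cell F N hc' (hlo.trans hlod') (by positivity) hw', hdd, e,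
        resid_add_mul_pow hρ₀p (hj.trans hJN)]
      constructor <;> linarith

/-- **Contraction of the mean map.**  On a nested window (`0 ≤ lo`, `N ≥ J` bits) the `n`-step mean of
StochasticA is `1`-Lipschitz on window grid points: `E[ŝₙ | ŝₖ = t'] − E[ŝₙ | ŝₖ = t] ≤ t' − t` for
`t ≤ t'` in `F ∩ [lo, hi]` (trees from `t`, `t'` unsaturated and inside the window). -/
theorem accExpQA_contract (hW : NestedWindow F lo hi g J) (hlo : 0 ≤ lo) {N : ℕ} (hJN : J ≤ N) :
    ∀ (x : ℕ → K) (n : ℕ) (t t' : K), t ∈ F → t' ∈ F → lo ≤ t → t' ≤ hi → t ≤ t' →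
      NoSat F x n t → InWindow F lo hi x n t → NoSat F x n t' → InWindow F lo hi x n t' →
      accExpQ F (probAwayA N) x n (fun y => y) t'
        - accExpQ F (probAwayA N) x n (fun y => y) t ≤ t' - t := by
  intro x n
  induction n generalizing x with
  | zero => intro t t' _ _ _ _ _ _ _ _ _; simp [accExpQ]
  | succ n ih =>
    rintro t t' ht ht' hlt hth htt ⟨hin, hnu, hnd⟩ ⟨⟨h1, h2⟩, hwu, hwd⟩ ⟨hin', hnu', hnd'⟩
      ⟨⟨h1', h2'⟩, hwu', hwd'⟩
    rw [clamp_eq_self hin] at h1 h2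
    rw [clamp_eq_self hin'] at h1' h2'
    have hcc : t + x 0 ≤ t' + x 0 := by linarith
    -- the lever, with `c' − c = t' − t ∈ g·ℤ`
    have hm := hW.grid t ht hlt (htt.trans hth)
    have hm' := hW.grid t' ht' (hlt.trans htt) hth
    have hk : (t' + x 0) - (t + x 0) = ((⌊(t' - lo) / g⌋ - ⌊(t - lo) / g⌋ : ℤ) : K) * g := by
      push_cast; linear_combination hm' - hm
    obtain ⟨hτ1, hτ2⟩ := hW.stepQA_lever hlo hJN h1 hcc h2' hk
    simp only [stepQ] at hτ1 hτ2
    obtain ⟨hdF, huF, hlod, huhi, hdc, hcu⟩ := hW.cand h1 h2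
    obtain ⟨hdF', huF', hlod', huhi', hdc', hcu'⟩ := hW.cand h1' h2'
    obtain ⟨hp0, hp1⟩ := pUpQ_mem F (probAwayA_mem N) (t + x 0)
    obtain ⟨hp0', hp1'⟩ := pUpQ_mem F (probAwayA_mem N) (t' + x 0)
    set q := probAwayA (K := K) N
    set x' : ℕ → K := fun i => x (i + 1)
    have IH1 := ih x' (dn F (t + x 0)) (up F (t + x 0)) hdF huF hlod huhi (hdc.trans hcu) hnd hwd hnu hwu
    have IH2 := ih x' (dn F (t' + x 0)) (up F (t' + x 0)) hdF' huF' hlod' huhi' (hdc'.trans hcu')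
      hnd' hwd' hnu' hwu'
    show stepQ F q (t' + x 0) (accExpQ F q x' n fun y => y)
        - stepQ F q (t + x 0) (accExpQ F q x' n fun y => y) ≤ t' - t
    simp only [stepQ]
    by_cases hsep : up F (t + x 0) ≤ dn F (t' + x 0)
    · have IH3 := ih x' (up F (t + x 0)) (dn F (t' + x 0)) huF hdF' (h1.trans hcu) (hdc'.trans h2')
        hsep hnu hwu hnd' hwd'
      set p := pUpQ F q (t + x 0)
      set p' := pUpQ F q (t' + x 0)
      have e1 := mul_le_mul_of_nonneg_left IH2 hp0'
      have e2 := mul_le_mul_of_nonneg_left IH1 (sub_nonneg.mpr hp1)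
      linarith [e1, e2, IH3, hτ2]
    · obtain ⟨hdd, huu⟩ := hW.cell_eq h1 hcc h2' (not_le.mp hsep)
      rw [hdd, huu] at hτ1 hτ2 ⊢
      set p := pUpQ F q (t + x 0)
      set p' := pUpQ F q (t' + x 0)
      rcases eq_or_lt_of_le (hdc.trans hcu) with hdu | hdu
      · rw [hdu]; linarith [htt]
      · have hpp : 0 ≤ p' - p :=
          (mul_nonneg_iff_of_pos_right (sub_pos.mpr hdu)).mp (by linarith [hτ1])
        have e1 := mul_le_mul_of_nonneg_left IH1 hpp
        linarith [e1, hτ2]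

/-- **StochasticA trees are drift-antitone on nested windows** (`N ≥ J` random bits, `0 ≤ lo`, no
saturation). -/
theorem driftAntitone_stochasticA (hW : NestedWindow F lo hi g J) (hlo : 0 ≤ lo) {N : ℕ} (hJN : J ≤ N) :
    ∀ (x : ℕ → K) (n : ℕ) (s : K), NoSat F x n s → InWindow F lo hi x n s →
      DriftAntitone F (probAwayA N) x n s := by
  intro x n
  induction n generalizing x with
  | zero => intro s _ _; trivial
  | succ n ih =>
    rintro s ⟨hin, hnu, hnd⟩ ⟨⟨h1, h2⟩, hwu, hwd⟩
    refine ⟨?_, ih _ _ hnu hwu, ih _ _ hnd hwd⟩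
    rw [clamp_eq_self hin] at h1 h2
    obtain ⟨hdF, huF, hlod, huhi, hdc, hcu⟩ := hW.cand h1 h2
    have := hW.accExpQA_contract hlo hJN (fun i => x (i + 1)) n (dn F (s + x 0)) (up F (s + x 0)) hdF
      huF hlod huhi (hdc.trans hcu) hnd hwd hnu hwu
    linarith

/-- **MSE of StochasticA across many binades, every `n`.**  On a one-signed nested window,
StochasticA with `N ≥ J` random bits obeys the Pythagorean law with `G = 2^J·g`, `ε = 2^{-N}`:
`E(ŝₙ − sₙ)² ≤ n·G²/4 + (n·2^{-N}·G)²`. -/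
theorem stochasticA_acc_sq_le (hW : NestedWindow F lo hi g J) (hlo : 0 ≤ lo) {N : ℕ} (hJN : J ≤ N)
    (x : ℕ → K) (n : ℕ) (s : K) (hns : NoSat F x n s) (hw : InWindow F lo hi x n s) :
    accExpQ F (probAwayA N) x n (fun t => (t - (s + ∑ i ∈ range n, x i)) ^ 2) s
      ≤ n * ((2 ^ J * g) ^ 2 / 4) + (n * (1 / 2 ^ N * (2 ^ J * g))) ^ 2 :=
  accExpQ_sq_le_of_driftAntitone F (probAwayA_mem N) (fun η _ _ => abs_probAwayA_sub_le N η) x n s hns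
    (hW.gapLE x n s hw) (hW.driftAntitone_stochasticA hlo hJN x n s hns hw)

end NestedWindow

end LimitedBits

end Summit.Ventures.CertifiedArithmetic.LowPrec.SR
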